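import Summits.QuantumFields.BalabanUV.Beta.FP.CompositeMinimiserJunction
import Summits.QuantumFields.BalabanUV.Beta.FP.PeriodisationBound
import Literature.MathematicalPhysics.QuantumFieldTheory.Balaban1983to89.B5Hk163Form166
import Summits.QuantumFields.BalabanUV.Beta.FP.PeriodicTransportSum

/-!
# `BalabanUV.Beta.FP.CompositeMinimiserDecay` — road «FP» for binder row D1, row **IR-5′** (b)∕(c) «THE fm LEG ON `ℤ^{d+1}`, UNCONDITIONAL»: an2's minimiser kernel `wH^{(N)}`
# (the fm block of the packed resolvent `KInv N` — the response of the fine field at `x` to a unit unnormalised block∘contour sum prescribed at the coarse bond `(q, l)`)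
# DECAYS EXPONENTIALLY ON THE COARSE SCALE, POINTWISE, WITH d-ONLY CONSTANTS, FOR EVERY `N ≥ 1`:
# `|wH κ l (N•x′ + a − N•q)| ≤ N^{−(d+2)} · MG163(d+1)·periodConst(κ₁₆₃(d+1), d) · e^{−(κ₁₆₃(d+1)∕(d+1))·‖x′ − q‖∞}` (`x′, q ∈ ℤ^{d+1}` block indices, `a` a digit vector) — the torus
# certificate `B5Hk163Torus.norm_HkOp_le` (pv15∕b05) carried to `ℤ^{d+1}` through this lineage's junction `CompositeMinimiserJunction.tsum_wH_pshift_eq_Hk` (g15), b05's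
# `B5Hk163Form166.HkOp_eq_Hk` ((1.63) = (1.103)) and the de-periodisation lemma `PeriodisationBound.abs_le_of_periodisations` (this gen); NO `Prop12Printed` hypothesis

HONEST DEPENDENCY (page 1, mandatory): continuum YM on T⁴ ⇐ BetaPertH ∧ nine spine estimates (0/9 proved); BetaPertH ⇐ (D1) ∧ (D4) ∧
CAP+tail; G-an2-4 gates asym, D1 and NE2/3/4.  HONEST FRAMING (cell contract, verbatim): «discharging `BetaPertH` makes Bałaban's UV
stability UNCONDITIONAL — a real constructive-QFT result; it is NOT the continuum limit and NOT the Clay problem.»  THIS MODULE proves ONE estimate about a ROAD object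
(an2's typed `U = 1` step system on `ℤ^{d+1}`, every `d`, every `N ≥ 1`) by composing TREE theorems BY NAME; it defines nothing, cites nothing as a hypothesis (`B5.Prop12Printed`
is NOT touched), mints no `Prop` fact, 0 sorry.  WHAT IT IS: the (I)-type letter of `IR5P-STATEMENT.md` §3 («`|𝓘(b,u)| ≤ C e^{−δ₀|y(b)−u|}`») for the literal's fm leg at
EVERY FINITE LEVEL, de-periodised, with the unit `N^{−(d+2)} = η^{d+1}` of ONE contour bond displayed (`IR5P-UNITS.md` §2 row fm); constants `MG163`, `κ₁₆₃`, `periodConst` are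
the b05∕pv15 lineage's (dimension-only, crude — never Bałaban's `O(1)`, `δ₀`).  OVERLAP, DISCLOSED: at `d = 3` and `N = Lc^(j+1)` the same SHAPE
`|wH κ l z| ≤ C·(N⁵)⁻¹·e^{−κ₀‖quo N z‖∞}` is ALREADY a tree theorem by a DIFFERENT route — gan24∕leaf-18's `GAN24/FineReadoutDecay.exists_wH_decay` (fibre-strip holomorphy on
`ℤ⁴`, existential `κ₀, C`), read by `FP/PerfectColumnSharp.wStepM_sharp`; the present module is the SECOND ENGINE for that letter (torus Fourier side: b05∕pv15 `H_k` + this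
lineage's junction + de-periodisation), concordant in shape, and extends it to every `d` and every `N ≥ 1` with named constants; it is the `ℤ^{d+1}` form of row IR-5′'s fm
DICTIONARY (`IR5P-UNITS.md` §2 row fm: torus form `CompositeMinimiserJunction`, de-periodised here).  WHAT IT IS NOT: not the `Q_j`-blocked∕`unitK`-rescaled (j, m) reading (a finite average of this
bound — the consumer's one line), not the gradient letter `∇_b𝓘`, not the ff block (`Gam`, whose torus avatar `½N²𝒞` has no sharp decay certificate in the tree yet), not the
j → ∞ passage; NOT hbook, NOT D1; 0∕4 row-D1 binders; NOT BetaPertH, NOT continuum, NOT Clay.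

ABSOLUTE RULE (cell charter, verbatim): «No internally-minted statement may enter as a cited fact. Every hypothesis is either kernel-proved in this
package or a verbatim quotation of a PUBLISHED theorem with page reference. The manuscript(s) under audit are NOT citable for their own disputed
steps — they are the thing under adjudication; programme-internal (2001/route/tribunal) claims are never citable.»

CONTENT (every `d`, `N ≥ 1`, torus `M`; [folklore] unless marked):
* §1 **`tsum_wH_pshift_coarse_shift`** (shifting the coarse base point by a period reindexes the periodisation), `periodic_tsum_wH` (the periodised fm column
  is `M`-periodic in the coarse base point), `periodic_toTor_block` (the torus class of `N•y + a` is `M`-periodic in `y`).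
* §2 **`tsum_wH_pshift_eq_HkOp`** — the junction at INTEGER coarse points: `Σ_t wH κ l (x − N•q + (NM)•t) = N^{−(d+2)}·HkOp N M (x mod NM, κ) (q mod M, l)` (g15's
  `tsum_wH_pshift_eq_Hk` + `apply_liftT_toTor` + `HkOp_eq_Hk`).
* §3 **`abs_tsum_wH_pshift_le`** — [our object] the TORUS bound: `|Σ_t wH κ l (N•x′ + a − N•q + (NM)•t)| ≤ N^{−(d+2)}·MG163·periodConst·e^{−(κ₁₆₃∕(d+1))·|x′ − q|_{T_M,∞}}`.
* §4 `summable_wH`, `torusSupNorm_cube_eq_supNorm` and **`abs_wH_block_le`** — [our object] THE DE-PERIODISED LETTER displayed in the title (cubic tori `M = (k+1, …, k+1)`, `k → ∞`);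
  **`abs_wH_le`** — the same at an arbitrary fine point `z` (`x′ := ⌊z∕N⌋ = quotOf N z`, `PeriodicTransportSum.resSite_add_zsmul_quotOf`).
Provenance: D1 formalisation swarm LEAF PROVER 05, unit `b2b-balaban-beta-d1-formalise-leaf-05` gen 16, 2026-08-21, road FP row IR-5′ (b) (owner words journal 2026-08-21T06:06:17Z (2));
«not in print; our proof»; no existing file touched.
-/

noncomputable section

namespace Summit.QuantumFields.BalabanUV.Beta.FP.CompositeMinimiserDecay

open Finset Filter Topology
open scoped BigOperators
open Literature.MathematicalPhysics.QuantumFieldTheory.Balaban1983to89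
open Literature.MathematicalPhysics.QuantumFieldTheory.Balaban1983to89.Beta
open AffineAveraging (Site toSite unitVec)
open B12Sec2to5 (l1 Decay510 summable_exp_neg_l1)
open B4ContourShift (supNorm)
open B4TorusKernel (periodConst)
open B4TorusKernel.MultiPeriod (torusSupNorm torusSupNorm_of_centred)
open B5Prop11Plancherel (Tor fine)
open B5Block118 (bpt)
open B5Hk163Strip (kappa163 kappa163_pos)
open B5Hk163Decay (MG163)
open B5Hk163Torus (HkOp norm_HkOp_le)
open B5Hk163Form166 (HkOp_eq_Hk)
open B6LowerBound2153Torus (toT)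
open KernelSpecInstance (wH decay_wH)
open FluctuationProjection (Hk)
open Summit.QuantumFields.BalabanUV.Beta.GAN24.TorusAvatar (toTor liftT Periodic toTor_liftT toTor_add toTor_bpt)
open Summit.QuantumFields.BalabanUV.Beta.GAN24.TorusPeriodise (pshift pshift_add pshift_fine pshift_unitVec toTor_pshift)
open Summit.QuantumFields.BalabanUV.Beta.FP.CompositeMinimiserJunction (tsum_wH_pshift_eq_Hk)
open Summit.QuantumFields.BalabanUV.Beta.FP.PeriodisationBound (abs_le_of_periodisations)
open DressedMomentNormalisation (resSite resOf)
open Summit.QuantumFields.BalabanUV.Beta.FP.PeriodicTransportSum (quotOf resSite_add_zsmul_quotOf)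

variable {d : ℕ} (N : ℕ) [NeZero N] (M : Fin (d + 1) → ℕ) [∀ ν, NeZero (M ν)]

/-! ## §1 Coarse-base-point periodicity of the periodised column and of the torus class of a block point -/

omit [∀ ν, NeZero (M ν)] in
/-- **SHIFTING THE COARSE BASE POINT BY A PERIOD REINDEXES THE PERIODISATION** [folklore]:
`Σ_t wH κ l (x − N•(q + pshift M s) + pshift (NM) t) = Σ_t wH κ l (x − N•q + pshift (NM) t)` (reindex `t ↦ t + s`; no summability needed). -/
theorem tsum_wH_pshift_coarse_shift (κ l : Fin (d + 1)) (x q s : Site (d + 1)) :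
    ∑' t : Site (d + 1), wH (N := N) κ l (x - (N : ℤ) • (q + pshift M s) + pshift (fine N M) t)
      = ∑' t : Site (d + 1), wH (N := N) κ l (x - (N : ℤ) • q + pshift (fine N M) t) := by
  rw [← (Equiv.addRight s).tsum_eq]
  refine tsum_congr fun t => ?_
  show wH (N := N) κ l (x - (N : ℤ) • (q + pshift M s) + pshift (fine N M) (t + s)) = wH (N := N) κ l (x - (N : ℤ) • q + pshift (fine N M) t)
  congr 1
  rw [pshift_add, pshift_fine N M s, smul_add]
  abel

omit [∀ ν, NeZero (M ν)] in
/-- [folklore] the periodised fm column is `M`-PERIODIC IN THE COARSE BASE POINT `q`. -/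
theorem periodic_tsum_wH (κ l : Fin (d + 1)) (x : Site (d + 1)) :
    Periodic M (fun q => ∑' t : Site (d + 1), wH (N := N) κ l (x - (N : ℤ) • q + pshift (fine N M) t)) := by
  intro q ν
  show ∑' t : Site (d + 1), wH (N := N) κ l (x - (N : ℤ) • (q + ((M ν : ℕ) : ℤ) • unitVec ν) + pshift (fine N M) t)
      = ∑' t : Site (d + 1), wH (N := N) κ l (x - (N : ℤ) • q + pshift (fine N M) t)
  rw [← pshift_unitVec M ν]
  exact tsum_wH_pshift_coarse_shift N M κ l x q (unitVec ν)

omit [NeZero N] [∀ ν, NeZero (M ν)] in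
/-- [folklore] the fine-torus class of the block point `N•y + a` is `M`-periodic in the block index `y`. -/
theorem periodic_toTor_block (a : Site (d + 1)) : Periodic M (fun y => toTor (fine N M) ((N : ℤ) • y + a)) := by
  intro y ν
  show toTor (fine N M) ((N : ℤ) • (y + ((M ν : ℕ) : ℤ) • unitVec ν) + a) = toTor (fine N M) ((N : ℤ) • y + a)
  rw [← pshift_unitVec M ν, smul_add, ← pshift_fine N M, show (N : ℤ) • y + pshift (fine N M) (unitVec ν) + a
      = ((N : ℤ) • y + a) + pshift (fine N M) (unitVec ν) by abel, toTor_add, toTor_pshift, add_zero]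

/-! ## §2 The junction at integer coarse points, in (1.63) form -/

/-- **THE fm JUNCTION AT INTEGER COARSE POINTS** [folklore]: for every fine point `x ∈ ℤ^{d+1}` and coarse point `q ∈ ℤ^{d+1}`,
`Σ_t wH κ l (x − N•q + (NM)•t) = N^{−(d+2)} · HkOp N M (x mod NM, κ) (q mod M, l)` — g15's `tsum_wH_pshift_eq_Hk` (stated at the canonical lift of a torus point) moved to
an arbitrary integer representative by §1's periodicity (`Periodic.apply_liftT_toTor`), and b05's `HkOp_eq_Hk` ((1.63) = (1.103), `a := 1`). -/
theorem tsum_wH_pshift_eq_HkOp (hN : 1 ≤ N) (κ l : Fin (d + 1)) (x q : Site (d + 1)) :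
    (((∑' t : Site (d + 1), wH (N := N) κ l (x - (N : ℤ) • q + pshift (fine N M) t)) : ℝ) : ℂ)
      = ((N : ℂ) ^ (d + 2))⁻¹ * HkOp N M (toTor (fine N M) x, κ) (toTor M q, l) := by
  have hper := (periodic_tsum_wH N M κ l x).apply_liftT_toTor q
  have h := tsum_wH_pshift_eq_Hk N hN M 1 one_pos κ l (toTor M q) x
  rw [hper] at h
  rw [h, HkOp_eq_Hk N hN M 1 one_pos]

/-! ## §3 The torus bound -/

/-- **THE TORUS BOUND ON THE PERIODISED fm COLUMN** [our object]: for block index `x′`, digit vector `j`, coarse point `q` (all integer) and EVERY torus `M`,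
`|Σ_t wH κ l (N•x′ + a_j − N•q + (NM)•t)| ≤ N^{−(d+2)} · MG163(d+1)·periodConst(κ₁₆₃(d+1), d) · e^{−(κ₁₆₃(d+1)∕(d+1))·|x′ − q|_{T_M,∞}}` — §2 + `B5Hk163Torus.norm_HkOp_le`
(`toTor_bpt` identifies the fine class of `N•x′ + a_j` with the block point `bpt N M (x′ mod M) j`). -/
theorem abs_tsum_wH_pshift_le (hN : 1 ≤ N) (κ l : Fin (d + 1)) (x' q : Site (d + 1)) (j : Fin (d + 1) → Fin N) :
    |∑' t : Site (d + 1), wH (N := N) κ l ((N : ℤ) • x' + toSite (fun i => (j i : ℕ)) - (N : ℤ) • q + pshift (fine N M) t)|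
      ≤ ((N : ℝ) ^ (d + 2))⁻¹ * (MG163 (d + 1) * periodConst (kappa163 (d + 1)) d *
          Real.exp (-(kappa163 (d + 1) / (d + 1) * torusSupNorm M (x' - q)))) := by
  have hblock : toTor (fine N M) ((N : ℤ) • x' + toSite (fun i => (j i : ℕ))) = bpt N M (toTor M x') j := by
    rw [← toTor_bpt N M (toTor M x') j]
    exact ((periodic_toTor_block N M (toSite (fun i => (j i : ℕ)))).apply_liftT_toTor x').symm
  have h := tsum_wH_pshift_eq_HkOp N M hN κ l ((N : ℤ) • x' + toSite (fun i => (j i : ℕ))) q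
  rw [hblock] at h
  have hnorm : |∑' t : Site (d + 1), wH (N := N) κ l ((N : ℤ) • x' + toSite (fun i => (j i : ℕ)) - (N : ℤ) • q + pshift (fine N M) t)|
      = ((N : ℝ) ^ (d + 2))⁻¹ * ‖HkOp N M (bpt N M (toTor M x') j, κ) (toTor M q, l)‖ := by
    rw [← Real.norm_eq_abs, ← Complex.norm_real, h, norm_mul, norm_inv, norm_pow, Complex.norm_natCast]
  rw [hnorm]
  refine mul_le_mul_of_nonneg_left ?_ (by positivity)
  exact norm_HkOp_le N M κ l j x' q

/-! ## §4 De-periodisation: the letter on `ℤ^{d+1}` -/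

/-- [folklore] an2's minimiser kernel is absolutely summable (`KernelSpecInstance.decay_wH`). -/
theorem summable_wH (κ l : Fin (d + 1)) : Summable (fun z : Site (d + 1) => wH (N := N) κ l z) := by
  obtain ⟨δ, C, hδ, h⟩ := decay_wH (N := N) (d := d)
  refine Summable.of_norm_bounded (g := fun z : Site (d + 1) => C * Real.exp (-δ * l1 z)) ((summable_exp_neg_l1 hδ (d + 1)).mul_left C)
    fun z => ?_
  rw [Real.norm_eq_abs]
  exact h κ l z

omit [NeZero N] [∀ ν, NeZero (M ν)] in
/-- [folklore] on a cubic torus of side `k + 1 ≥ 2‖z‖∞` the torus sup-distance of `z` is its sup norm. -/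
theorem torusSupNorm_cube_eq_supNorm (z : Site (d + 1)) {k : ℕ} (hk : ∀ i, 2 * |z i| ≤ ((k + 1 : ℕ) : ℤ)) :
    torusSupNorm (fun _ : Fin (d + 1) => k + 1) z = supNorm z :=
  torusSupNorm_of_centred (N := fun _ : Fin (d + 1) => k + 1) (fun _ => Nat.succ_pos k) hk

/-- **THE fm LEG ON `ℤ^{d+1}`, UNCONDITIONAL** [our object]: for every `d`, every `N ≥ 1`, fine direction `κ`, coarse bond direction `l`, block index `x′ ∈ ℤ^{d+1}`, digit vector `j`
and coarse point `q ∈ ℤ^{d+1}`,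
`|wH κ l (N•x′ + a_j − N•q)| ≤ N^{−(d+2)} · (MG163(d+1)·periodConst(κ₁₆₃(d+1), d)) · e^{−(κ₁₆₃(d+1)∕(d+1))·‖x′ − q‖∞}`
— §3 on the cubic tori `M = (k+1, …, k+1)` and `PeriodisationBound.abs_le_of_periodisations` (`k → ∞`; `|x′ − q|_{T_M,∞} = ‖x′ − q‖∞` once `k + 1 ≥ 2‖x′ − q‖∞`). -/
theorem abs_wH_block_le (hN : 1 ≤ N) (κ l : Fin (d + 1)) (x' q : Site (d + 1)) (j : Fin (d + 1) → Fin N) :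
    |wH (N := N) κ l ((N : ℤ) • x' + toSite (fun i => (j i : ℕ)) - (N : ℤ) • q)|
      ≤ ((N : ℝ) ^ (d + 2))⁻¹ * (MG163 (d + 1) * periodConst (kappa163 (d + 1)) d) *
          Real.exp (-(kappa163 (d + 1) / (d + 1) * supNorm (x' - q))) := by
  -- the cubic tori and their fine period lattices
  let P : ℕ → Fin (d + 1) → ℕ := fun k => fine N (fun _ : Fin (d + 1) => k + 1)
  have hP1 : ∀ k ν, 1 ≤ P k ν := fun k ν => by
    show 1 ≤ N * (k + 1)
    exact Nat.one_le_iff_ne_zero.mpr (Nat.mul_ne_zero (NeZero.ne N) (Nat.succ_ne_zero k))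
  have hP : ∀ R : ℕ, ∀ᶠ k in atTop, ∀ ν, R ≤ P k ν := fun R => by
    refine (eventually_ge_atTop R).mono fun k hk ν => ?_
    show R ≤ N * (k + 1)
    calc R ≤ k + 1 := hk.trans (Nat.le_succ k)
      _ ≤ N * (k + 1) := Nat.le_mul_of_pos_left _ hN
  -- the eventual torus bound, with the torus distance already the lattice distance
  have hB : ∀ᶠ k in atTop, |∑' t : Site (d + 1), wH (N := N) κ l ((N : ℤ) • x' + toSite (fun i => (j i : ℕ)) - (N : ℤ) • q + pshift (P k) t)|
      ≤ ((N : ℝ) ^ (d + 2))⁻¹ * (MG163 (d + 1) * periodConst (kappa163 (d + 1)) d) *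
          Real.exp (-(kappa163 (d + 1) / (d + 1) * supNorm (x' - q))) := by
    obtain ⟨R, hR⟩ : ∃ R : ℕ, ∀ i, 2 * |(x' - q) i| ≤ (R : ℤ) :=
      ⟨2 * Finset.univ.sup (fun i => ((x' - q) i).natAbs), fun i => by
        have h1 : ((x' - q) i).natAbs ≤ Finset.univ.sup (fun i => ((x' - q) i).natAbs) :=
          Finset.le_sup (f := fun i => ((x' - q) i).natAbs) (Finset.mem_univ i)
        have h2 : |(x' - q) i| = (((x' - q) i).natAbs : ℤ) := (Int.natCast_natAbs _).symm
        rw [h2]; push_cast; omega⟩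
    refine (eventually_ge_atTop R).mono fun k hk => ?_
    have hk' : ∀ i, 2 * |(x' - q) i| ≤ ((k + 1 : ℕ) : ℤ) := fun i => (hR i).trans (by exact_mod_cast hk.trans (Nat.le_succ k))
    have h := abs_tsum_wH_pshift_le N (fun _ : Fin (d + 1) => k + 1) hN κ l x' q j
    rw [torusSupNorm_cube_eq_supNorm (x' - q) hk'] at h
    refine h.trans (le_of_eq ?_)
    ring
  exact abs_le_of_periodisations (summable_wH N κ l) _ hP1 hP hB

/-- **THE fm LEG ON `ℤ^{d+1}` AT AN ARBITRARY FINE POINT** [our object]: for every `z, q ∈ ℤ^{d+1}`,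
`|wH κ l (z − N•q)| ≤ N^{−(d+2)} · (MG163(d+1)·periodConst(κ₁₆₃(d+1), d)) · e^{−(κ₁₆₃(d+1)∕(d+1))·‖⌊z∕N⌋ − q‖∞}` — `abs_wH_block_le` at the coordinatewise Euclidean
decomposition `z = N•⌊z∕N⌋ + (z mod N)` (`PeriodicTransportSum.resSite_add_zsmul_quotOf`; `⌊z∕N⌋ = quotOf N z`). -/
theorem abs_wH_le (hN : 1 ≤ N) (κ l : Fin (d + 1)) (z q : Site (d + 1)) :
    |wH (N := N) κ l (z - (N : ℤ) • q)|
      ≤ ((N : ℝ) ^ (d + 2))⁻¹ * (MG163 (d + 1) * periodConst (kappa163 (d + 1)) d) *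
          Real.exp (-(kappa163 (d + 1) / (d + 1) * supNorm (quotOf N z - q))) := by
  have h := abs_wH_block_le N hN κ l (quotOf N z) q (resOf hN z)
  have e : (N : ℤ) • quotOf N z + toSite (fun i => ((resOf hN z i : ℕ))) = z :=
    (add_comm _ _).trans (resSite_add_zsmul_quotOf hN z)
  rw [e] at h
  exact h

end Summit.QuantumFields.BalabanUV.Beta.FP.CompositeMinimiserDecay

end
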